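import Summits.Ventures.HSemireg.WedgeKunnethKernelLow

/-!
# Venture HSemireg — THE KÜNNETH KERNEL LAW (3/3), FLAT FORM over any finite splitting:
# `Kr(⋃_{i<n} D_i, f₀ ∧ ⋯ ∧ f_{n−1}, k) = Σ_{i<n} Σ_{b ≤ k} Kr(D_i, f_i, b) ∧ Hom(⋃_{j≠i} D_j, k − b)` — every degree, every number of factors

HONEST FRAMING. Part of the Lean index of the computation cell `pub-hsemireg` (seat p10 gen 13, Sunday typer «UNIFORM-IN-n»).
Finite-dimensional EXTERIOR ALGEBRA over a field ONLY: no variety, no cohomology theory, no sheaf, no Ext group and no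
semiregularity map is constructed here; nothing here says that HC / HC_CM / HC_AV holds; no Literature fact is declared or
used.  Custodian versions cited: theory/FORMULA-N.md PART A §2.3 THEOREM K (iterated: «the block form iterates», gen 6's
`WedgeMixedBox.rankPoly_prodR`), PART B §A.3 / §N.3 / §N.7 (a); STRUCTURE.md v1.0-SIGNED 9b196a05977dd067 §1.1 C4 / C10.  The
dictionary (`HT^k(X₀ × ⋯ × X_{n−1})` ↔ `⋀^k` on the disjoint union of the generator blocks; `⌟ch(E₀ ⊠ ⋯ ⊠ E_{n−1})` ↔ `θ ↦ θ ∧ (f₀ ∧ ⋯ ∧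
f_{n−1})`, sign-blind) is QUOTED, never asserted.

WHAT IS KEYED.  `WedgeKunnethKernel` (C1, 712): THE KÜNNETH KERNEL LAW for two blocks, `Kr(D₁ ⊔ D₂, f₁f₂, k) = Σ_{a+b=k} ( Kr(D₁,f₁,a) ∧
Hom(D₂,b) + Hom(D₁,a) ∧ Kr(D₂,f₂,b) )`; `WedgeKunnethKernelLow` (C2, 720): its recursion over gen 6's ordered products `prodR` on pairwise
disjoint blocks (`Kr_prodR_succ`) and the degree-2 kernel of a box of non-degenerate factors.  THIS FILE unrolls the recursion into a
CLOSED, FLAT NAME of the kernel of an `n`-fold product in EVERY degree: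
* §1 block bookkeeping: the OTHER blocks `oth j i := ⋃_{i′<j, i′≠i} D_{i′}` of a prefix (`oth_succ`, `disjoint_D_oth`, `D_union_oth`, …);
  and **`prodR_eq_smul_mul`: `f 0 ∧ ⋯ ∧ f (j−1) = ε · f_i ∧ R`** with `ε ≠ 0` and `R` homogeneous on the other blocks
  (graded commutation moves any factor to the front — no sign is ever evaluated).
* §2 the flat terms **`T j i k := Σ_{b ≤ k} Kr(D_i, f_i, b) ∧ Hom(oth j i, k − b)`** («killed through factor `i`») and the easy half
  **`T_le_Kr`**: each lies in the kernel of the prefix product.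
* §3 **THE FLAT KÜNNETH KERNEL LAW `Kr_prodR_eq_iSup_T`: `Kr(⋃_{i<j} D_i, f 0 ∧ ⋯ ∧ f (j−1), k) = Σ_{i<j} T j i k`** for every `1 ≤ j ≤ n`
  and every `k` — every field, any number of pairwise disjoint blocks, any homogeneous classes: A FORM KILLS THE PRODUCT IFF IT IS A SUM
  OF FORMS EACH OF WHICH ALREADY KILLS ONE FACTOR (times anything on the other blocks).  Proof: induction on `j` through C2's recursion,
  element-wise (no lattice algebra): a generator `(x ∧ w) ∧ y` of `Kr(pre j, F_j, a) ∧ Hom(D_j, k−a)` with `x ∈ Kr(D_i, f_i, b)`,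
  `w ∈ Hom(oth j i, a−b)` regroups as `x ∧ (w ∧ y)` with `w ∧ y ∈ Hom(oth (j+1) i, k−b)`, and `Hom(pre j, a) ∧ Kr(D_j, f_j, k−a)` commutes into
  `T (j+1) j k`.  Wedge form **`ker_wedge_prodR_eq`** when the blocks cover the generators.
* §4 degrees `0` and `1` for NON-ZERO factors: `prodR_ne_zero` (the product is non-zero) and **`Kr_prodR_one_eq`: the `1`-forms killing the
  product are exactly the sums of `1`-forms killing a factor, `Kr(⋃ D_i, F, 1) = ⊔_i Kr(D_i, f_i, 1)`**.
NOT typed here: the Hankel specialisation beyond degree `2` (it is `Kr_prodR_eq_iSup_T` with `Kr(block_i, v_i, b)` = gen 11/12's Siegel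
ideal plus the Hankel excess, by value through `Kr`); dimensions of the flat terms (they overlap for `n ≥ 3` exactly as inclusion–exclusion
predicts — C2's co-polynomial law is the two-block count); anything Ext-side.  Class side only.
Namespace `Summit.Ventures.HSemireg.Wedge.KunnethKernel` (continued); new names only.
-/

open Module

namespace Summit.Ventures.HSemireg.Wedge.KunnethKernel

open Summit.Ventures.HSemireg.Wedge Summit.Ventures.HSemireg.Wedge.Kunneth Summit.Ventures.HSemireg.Wedge.MixedBox

variable (K : Type*) [Field K] {I : Type*} [LinearOrder I] [Fintype I]

/-! ## §1. Block bookkeeping and moving a factor to the front -/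

section Split

variable {n : ℕ} {D : ℕ → Finset I} {d : ℕ → ℕ} {f : ℕ → HT K I}

omit [Fintype I] in
/-- the OTHER blocks of the prefix `j`, seen from factor `i`: `oth j i = ⋃_{i′ < j, i′ ≠ i} D_{i′}`. -/
def oth (D : ℕ → Finset I) (j i : ℕ) : Finset I := ((Finset.range j).erase i).biUnion D

omit [Fintype I] in
/-- `oth (i+1) i = ⋃_{i′<i} D_{i′}`: seen from the last factor, the other blocks are the previous prefix. -/
lemma oth_succ_self (D : ℕ → Finset I) (i : ℕ) : oth D (i + 1) i = (Finset.range i).biUnion D := by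
  rw [oth, Finset.range_add_one, Finset.erase_insert (Finset.notMem_range_self)]

omit [Fintype I] in
/-- one more block, not the distinguished one: `oth (j+1) i = oth j i ∪ D_j` for `i ≠ j`. -/
lemma oth_succ {i j : ℕ} (hij : i ≠ j) : oth D (j + 1) i = oth D j i ∪ D j := by
  rw [oth, oth, Finset.range_add_one, Finset.erase_insert_of_ne hij.symm, Finset.biUnion_insert, Finset.union_comm]

omit [Fintype I] in
/-- the other blocks lie in the prefix. -/
lemma oth_subset (D : ℕ → Finset I) (j i : ℕ) : oth D j i ⊆ (Finset.range j).biUnion D :=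
  Finset.biUnion_subset_biUnion_of_subset_left D (Finset.erase_subset i _)

omit [Fintype I] in
/-- the distinguished block is disjoint from the other blocks (`i < j ≤ n`, blocks pairwise disjoint below `n`). -/
lemma disjoint_D_oth (hD : ∀ i j, i < j → j < n → Disjoint (D i) (D j)) {i j : ℕ} (hij : i < j) (hjn : j ≤ n) :
    Disjoint (D i) (oth D j i) := by
  rw [oth, Finset.disjoint_biUnion_right]
  intro i' hi'
  obtain ⟨hne, hlt⟩ := Finset.mem_erase.mp hi'
  rw [Finset.mem_range] at hlt
  rcases Nat.lt_or_gt_of_ne hne with h | h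
  · exact (hD i' i h (by omega)).symm
  · exact hD i i' h (by omega)

omit [Fintype I] in
/-- the other blocks of the prefix `j < n` are disjoint from the next block `D_j`. -/
lemma disjoint_oth_D (hD : ∀ i j, i < j → j < n → Disjoint (D i) (D j)) (i : ℕ) {j : ℕ} (hjn : j < n) :
    Disjoint (oth D j i) (D j) :=
  Finset.disjoint_of_subset_left (oth_subset D j i) (disjoint_biUnion_range hD hjn)

omit [Fintype I] in
/-- the distinguished block and the other blocks make up the prefix: `D_i ∪ oth j i = ⋃_{i′<j} D_{i′}` (`i < j`). -/
lemma D_union_oth {i j : ℕ} (hij : i < j) : D i ∪ oth D j i = (Finset.range j).biUnion D := by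
  rw [oth, ← Finset.biUnion_insert, Finset.insert_erase (Finset.mem_range.mpr hij)]

/-- the empty prefix product is the unit, homogeneous of degree `0` on `∅`. -/
lemma prodR_zero_mem_Hom (f : ℕ → HT K I) : prodR K f 0 ∈ Hom K I (∅ : Finset I) 0 := by
  rw [show prodR K f 0 = 1 from rfl, Hom_zero_eq_one]
  exact Submodule.one_le.mp le_rfl

/-- every prefix product (including the empty one) is homogeneous on its prefix. -/
lemma prodR_mem_Hom (hf : ∀ i, i < n → f i ∈ Hom K I (D i) (d i)) (hD : ∀ i j, i < j → j < n → Disjoint (D i) (D j))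
    {j : ℕ} (hjn : j ≤ n) : prodR K f j ∈ Hom K I ((Finset.range j).biUnion D) (∑ i ∈ Finset.range j, d i) := by
  rcases Nat.eq_zero_or_pos j with rfl | hj
  · rw [Finset.range_zero, Finset.biUnion_empty, Finset.sum_empty]; exact prodR_zero_mem_Hom K f
  · exact (rankPoly_prodR K hf hD j hj hjn).1

/-- **MOVING A FACTOR TO THE FRONT: `f 0 ∧ ⋯ ∧ f (j−1) = ε · (f_i ∧ R)`** with `ε ≠ 0` and `R` homogeneous on the other blocks `oth j i`
(`i < j ≤ n`; graded commutation, no sign evaluated). -/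
theorem prodR_eq_smul_mul (hf : ∀ i, i < n → f i ∈ Hom K I (D i) (d i)) (hD : ∀ i j, i < j → j < n → Disjoint (D i) (D j))
    {i : ℕ} : ∀ {j : ℕ}, i < j → j ≤ n →
      ∃ (ε : K) (e : ℕ) (R : HT K I), ε ≠ 0 ∧ R ∈ Hom K I (oth D j i) e ∧ prodR K f j = ε • (f i * R) := by
  intro j hij hjn
  induction j with
  | zero => omega
  | succ j ih =>
    have hjn' : j < n := by omega
    rcases Nat.lt_or_ge i j with h | h
    · obtain ⟨ε, e, R, hε, hR, hP⟩ := ih h hjn'.le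
      refine ⟨ε, e + d j, R * f j, hε, ?_, ?_⟩
      · rw [oth_succ h.ne]
        exact Kunneth.mul_mem_Hom K (disjoint_oth_D hD i hjn') hR (hf j hjn')
      · rw [prodR_succ, hP, smul_mul_assoc, mul_assoc]
    · have hi : i = j := by omega
      subst hi
      refine ⟨(-1 : K) ^ ((∑ i' ∈ Finset.range i, d i') * d i), ∑ i' ∈ Finset.range i, d i', prodR K f i,
        pow_ne_zero _ (neg_ne_zero.mpr one_ne_zero), ?_, ?_⟩
      · rw [oth_succ_self]; exact prodR_mem_Hom K hf hD hjn'.le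
      · rw [prodR_succ]
        exact mul_comm_Hom K (prodR_mem_Hom K hf hD hjn'.le) (hf i hjn')

/-! ## §2. The flat terms and the easy half -/

/-- **the FLAT TERM `T j i k := Σ_{b ≤ k} Kr(D_i, f_i, b) ∧ Hom(oth j i, k − b)`**: degree-`k` forms on the prefix `j` killed THROUGH FACTOR `i`
(a factor-kernel form on block `i` times anything on the other blocks). -/
noncomputable def T (D : ℕ → Finset I) (f : ℕ → HT K I) (j i k : ℕ) : Submodule K (HT K I) :=
  ⨆ b ∈ Finset.range (k + 1), Kr K (D i) (f i) b * Hom K I (oth D j i) (k - b)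

/-- **the easy half: `T j i k ≤ Kr(⋃_{i′<j} D_{i′}, f 0 ∧ ⋯ ∧ f (j−1), k)`** (`i < j ≤ n`): `(x ∧ y) ∧ (ε f_i ∧ R) = ± ε (x ∧ f_i) ∧ y ∧ R = 0`. -/
theorem T_le_Kr (hf : ∀ i, i < n → f i ∈ Hom K I (D i) (d i)) (hD : ∀ i j, i < j → j < n → Disjoint (D i) (D j))
    {i j : ℕ} (hij : i < j) (hjn : j ≤ n) (k : ℕ) :
    T K D f j i k ≤ Kr K ((Finset.range j).biUnion D) (prodR K f j) k := by
  obtain ⟨ε, e, R, -, hR, hP⟩ := prodR_eq_smul_mul K hf hD hij hjn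
  refine iSup₂_le fun b hb => Submodule.mul_le.mpr fun x hx y hy => ?_
  have hbk : b + (k - b) = k := by rw [Finset.mem_range] at hb; omega
  obtain ⟨hxH, hxf⟩ := mem_Kr.mp hx
  refine mem_Kr.mpr ⟨?_, ?_⟩
  · have h := Kunneth.mul_mem_Hom K (disjoint_D_oth hD hij hjn) hxH hy
    rwa [D_union_oth hij, hbk] at h
  · rw [hP, mul_smul_comm, mul_mul_mul_eq K (hf i (by omega)) hy, hxf, zero_mul, smul_zero, smul_zero]

/-! ## §3. The flat law -/

/-- one prefix factor (`j = 1`): `Kr(D_0, f_0, k) ≤ T 1 0 k` (the term `b = k`, times `Hom(∅, 0) ∋ 1`). -/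
lemma Kr_le_T_one (k : ℕ) : Kr K (D 0) (f 0) k ≤ T K D f 1 0 k := by
  intro θ hθ
  have h1 : θ * 1 ∈ Kr K (D 0) (f 0) k * Hom K I (oth D 1 0) (k - k) := by
    refine Submodule.mul_mem_mul hθ ?_
    rw [Nat.sub_self, Hom_zero_eq_one]
    exact Submodule.one_le.mp le_rfl
  rw [mul_one] at h1
  exact Submodule.mem_iSup_of_mem k (Submodule.mem_iSup_of_mem (Finset.self_mem_range_succ k) h1)

/-- regrouping step for the first summand of the recursion: **`T j i a ∧ Hom(D_j, k − a) ≤ T (j+1) i k`** (`i < j < n`, `a ≤ k`):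
`(x ∧ w) ∧ y = x ∧ (w ∧ y)` with `w ∧ y ∈ Hom(oth (j+1) i, k − b)`. -/
lemma T_mul_Hom_le (hD : ∀ i j, i < j → j < n → Disjoint (D i) (D j)) {i j : ℕ} (hij : i < j) (hjn : j < n) {a k : ℕ} (hak : a ≤ k) :
    T K D f j i a * Hom K I (D j) (k - a) ≤ T K D f (j + 1) i k := by
  rw [Submodule.mul_le]
  intro z hz y hy
  induction hz using Submodule.iSup_induction' with
  | mem b z hz =>
    induction hz using Submodule.iSup_induction' with
    | mem hb z hz =>
      have hb' : b ≤ a := by have := Finset.mem_range.mp hb; omega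
      refine Submodule.mul_induction_on hz (fun x hx w hw => ?_) (fun z₁ z₂ h₁ h₂ => by rw [add_mul]; exact Submodule.add_mem _ h₁ h₂)
      have hwy : w * y ∈ Hom K I (oth D (j + 1) i) (k - b) := by
        have h := Kunneth.mul_mem_Hom K (disjoint_oth_D hD i hjn) hw hy
        rwa [← oth_succ hij.ne, show a - b + (k - a) = k - b by omega] at h
      rw [mul_assoc]
      exact Submodule.mem_iSup_of_mem b (Submodule.mem_iSup_of_mem (Finset.mem_range.mpr (by omega))
        (Submodule.mul_mem_mul hx hwy))
    | zero => rw [zero_mul]; exact Submodule.zero_mem _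
    | add z₁ z₂ _ _ h₁ h₂ => rw [add_mul]; exact Submodule.add_mem _ h₁ h₂
  | zero => rw [zero_mul]; exact Submodule.zero_mem _
  | add z₁ z₂ _ _ h₁ h₂ => rw [add_mul]; exact Submodule.add_mem _ h₁ h₂

/-- commutation step for the second summand: **`Hom(⋃_{i<j} D_i, a) ∧ Kr(D_j, f_j, k − a) ≤ T (j+1) j k`** (`a ≤ k`): `x ∧ y = ± y ∧ x`. -/
lemma Hom_mul_Kr_le_T {j : ℕ} {a k : ℕ} (hak : a ≤ k) :
    Hom K I ((Finset.range j).biUnion D) a * Kr K (D j) (f j) (k - a) ≤ T K D f (j + 1) j k := by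
  rw [Submodule.mul_le]
  intro x hx y hy
  have hyx : y * x ∈ Kr K (D j) (f j) (k - a) * Hom K I (oth D (j + 1) j) (k - (k - a)) := by
    rw [oth_succ_self, show k - (k - a) = a by omega]
    exact Submodule.mul_mem_mul hy hx
  rw [mul_comm_Hom K hx (Kr_le_Hom K _ _ _ hy)]
  exact Submodule.smul_mem _ _ (Submodule.mem_iSup_of_mem (k - a)
    (Submodule.mem_iSup_of_mem (Finset.mem_range.mpr (by omega)) hyx))

/-- **THE FLAT KÜNNETH KERNEL LAW: `Kr(⋃_{i<j} D_i, f 0 ∧ ⋯ ∧ f (j−1), k) = Σ_{i<j} Σ_{b ≤ k} Kr(D_i, f_i, b) ∧ Hom(oth j i, k − b)`** for every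
`1 ≤ j ≤ n` and every degree `k` — every field, any pairwise disjoint blocks, any homogeneous classes: a form kills the product iff it is a
sum of forms each killing ONE factor (times anything on the other blocks). -/
theorem Kr_prodR_eq_iSup_T (hf : ∀ i, i < n → f i ∈ Hom K I (D i) (d i)) (hD : ∀ i j, i < j → j < n → Disjoint (D i) (D j)) :
    ∀ j, 1 ≤ j → j ≤ n → ∀ k,
      Kr K ((Finset.range j).biUnion D) (prodR K f j) k = ⨆ i ∈ Finset.range j, T K D f j i k := by
  intro j hj1 hjn
  induction j with
  | zero => omega
  | succ j ih =>
    intro k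
    have hjn' : j < n := by omega
    apply le_antisymm
    · rcases Nat.eq_zero_or_pos j with rfl | hjpos
      · rw [zero_add, Finset.range_one, Finset.singleton_biUnion, prodR_one]
        exact (Kr_le_T_one K k).trans (le_iSup₂_of_le 0 (Finset.mem_singleton_self 0) le_rfl)
      · rw [Kr_prodR_succ K hf hD hjpos hjn' k]
        refine iSup₂_le fun a ha => ?_
        have hak : a ≤ k := by have := Finset.mem_range.mp ha; omega
        refine sup_le ?_ ?_
        · rw [ih hjpos hjn'.le a]
          rw [Submodule.mul_le]
          intro z hz y hy
          induction hz using Submodule.iSup_induction' with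
          | mem i z hz =>
            induction hz using Submodule.iSup_induction' with
            | mem hi z hz =>
              have hij : i < j := Finset.mem_range.mp hi
              exact Submodule.mem_iSup_of_mem i (Submodule.mem_iSup_of_mem (Finset.mem_range.mpr (by omega))
                (T_mul_Hom_le K hD hij hjn' hak (Submodule.mul_mem_mul hz hy)))
            | zero => rw [zero_mul]; exact Submodule.zero_mem _
            | add z₁ z₂ _ _ h₁ h₂ => rw [add_mul]; exact Submodule.add_mem _ h₁ h₂
          | zero => rw [zero_mul]; exact Submodule.zero_mem _
          | add z₁ z₂ _ _ h₁ h₂ => rw [add_mul]; exact Submodule.add_mem _ h₁ h₂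
        · exact (Hom_mul_Kr_le_T K hak).trans (le_iSup₂_of_le j (Finset.self_mem_range_succ j) le_rfl)
    · exact iSup₂_le fun i hi => T_le_Kr K hf hD (Finset.mem_range.mp hi) hjn k

/-- **WEDGE FORM: `ker(θ ↦ θ ∧ (f 0 ∧ ⋯ ∧ f (n−1)) ∣ ⋀^k) = Σ_{i<n} Σ_{b ≤ k} Kr(D_i, f_i, b) ∧ Hom(oth n i, k − b)`** when the `n ≥ 1` blocks
cover the generators. -/
theorem ker_wedge_prodR_eq (hn : 1 ≤ n) (hf : ∀ i, i < n → f i ∈ Hom K I (D i) (d i))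
    (hD : ∀ i j, i < j → j < n → Disjoint (D i) (D j)) (hcov : (Finset.range n).biUnion D = Finset.univ) (k : ℕ) :
    LinearMap.ker (wedge K I k (prodR K f n)) = (⨆ i ∈ Finset.range n, T K D f n i k).comap (⋀[K]^k (I → K)).subtype := by
  rw [ker_wedge_eq_comap_Kr, ← hcov, Kr_prodR_eq_iSup_T K hf hD n hn le_rfl k]

/-- **a factor killed by nothing up to degree `k` contributes nothing in degree `k`**: if `Kr(D_i, f_i, b) = 0` for all `b ≤ k` then
`T j i k = 0` (so in `Kr_prodR_eq_iSup_T` only the factors with a kernel in some degree `≤ k` appear). -/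
theorem T_eq_bot_of_forall {j i k : ℕ} (h : ∀ b, b ≤ k → Kr K (D i) (f i) b = ⊥) : T K D f j i k = ⊥ := by
  rw [T, eq_bot_iff]
  refine iSup₂_le fun b hb => ?_
  rw [h b (by have := Finset.mem_range.mp hb; omega), Submodule.bot_mul]

/-! ## §4. Degrees 0 and 1 for non-zero factors -/

/-- **a product of NON-ZERO homogeneous classes on pairwise disjoint blocks is non-zero** (every prefix, `j ≤ n`). -/
theorem prodR_ne_zero (hf : ∀ i, i < n → f i ∈ Hom K I (D i) (d i)) (hD : ∀ i j, i < j → j < n → Disjoint (D i) (D j))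
    (h0 : ∀ i, i < n → f i ≠ 0) : ∀ {j : ℕ}, j ≤ n → prodR K f j ≠ 0 := by
  intro j hjn
  induction j with
  | zero => rw [show prodR K f 0 = 1 from rfl]; exact one_ne_zero
  | succ j ih =>
    have hj : j < n := by omega
    rw [prodR_succ]
    exact mul_ne_zero_of_mem_Hom K (disjoint_biUnion_range hD hj) (prodR_mem_Hom K hf hD hj.le) (hf j hj) (ih hj.le) (h0 j hj)

/-- the flat term of a NON-ZERO factor in degree `1` is its own degree-1 kernel space: `T j i 1 = Kr(D_i, f_i, 1)`. -/
lemma T_one_eq {j i : ℕ} (h0 : f i ≠ 0) : T K D f j i 1 = Kr K (D i) (f i) 1 := by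
  rw [T, ← Finset.sup_eq_iSup]
  simp only [Finset.range_add_one, Finset.range_zero, Finset.sup_insert, Finset.insert_empty, Finset.sup_singleton,
    Kr_zero_eq_bot K _ h0, Submodule.bot_mul, sup_bot_eq, Nat.sub_self, Hom_zero_eq_one, Submodule.mul_one]

/-- **THE 1-FORMS KILLING A PRODUCT OF NON-ZERO CLASSES ARE THE SUMS OF 1-FORMS KILLING A FACTOR:
`Kr(⋃_{i<j} D_i, f 0 ∧ ⋯ ∧ f (j−1), 1) = ⊔_{i<j} Kr(D_i, f_i, 1)`** (`1 ≤ j ≤ n`; every field, blocks, non-zero homogeneous classes). -/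
theorem Kr_prodR_one_eq (hf : ∀ i, i < n → f i ∈ Hom K I (D i) (d i)) (hD : ∀ i j, i < j → j < n → Disjoint (D i) (D j))
    (h0 : ∀ i, i < n → f i ≠ 0) {j : ℕ} (hj1 : 1 ≤ j) (hjn : j ≤ n) :
    Kr K ((Finset.range j).biUnion D) (prodR K f j) 1 = ⨆ i ∈ Finset.range j, Kr K (D i) (f i) 1 := by
  rw [Kr_prodR_eq_iSup_T K hf hD j hj1 hjn 1]
  exact iSup_congr fun i => iSup_congr fun hi => T_one_eq K (h0 i (by have := Finset.mem_range.mp hi; omega))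

end Split

end Summit.Ventures.HSemireg.Wedge.KunnethKernel
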